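import Literature.MathematicalPhysics.QuantumFieldTheory.Balaban1983to89.B9Ineq3137LocalSup
import Literature.MathematicalPhysics.QuantumFieldTheory.Balaban1983to89.B7AvgPeriodicity

/-!
# `Balaban1983to89.B7Eq136SecondOrderPeriodic` — T. Bałaban, *Averaging operations for lattice gauge theories*, Commun. Math. Phys. **98**
(1985) 17–51 [Balaban1985Averaging], (136) p. 39 with (149) p. 40, p. 19 («Ω^{(j)} may be replaced by any other lattice») and p. 24
(locality): **THE POLARISED SECOND-ORDER FORM `C_j⁽²⁾(U₀; ·, ·)(c)` ON TORUS BOND FIELDS** — for a field `a` on the bonds of the discrete torus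
`(ℤ/Tℤ)ᵈ` read on `ℤᵈ` by periodic extension, the quadratic form `a ↦ C_j⁽²⁾(U₀, ã)(c)` IS a continuous symmetric bilinear form `P_c(a, a)∕2`
(defined through the box chart of p. 24), and (149) gives its ENTRIES print's shape: `‖P_c(a, δ_w ⊗ x)‖ ≤ C₃(Lʲ)²·‖a‖_∞·L^{−jd}·N_c(w)·‖x‖`
with `N_c(w) ∈ {0, 1}` the number of bonds of `Bʲ(c₋) ∪ Bʲ(c₊)` projecting to the torus bond `w` (`= 0` unless `w` is adjacent to `c`; `≤ 1`
once the box fits in one period, `2Lʲ ≤ T`)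

statement-level skeleton of published theorems with citation tags; proofs where landed; nothing here is a claim about the Yang–Mills mass gap

PDF held: `paper:balaban1985-cmp98-averaging` (journal page = PDF page + 16); pp. 19, 24, 39–40 through the verbatim quotations of `B7Prop1Local`
(p. 24 locality), `B7AvgPeriodicity` (p. 19), `B7Eq136SecondOrder` ((136)), `B7Ineq149Pairing` ((149), (141)); [B12] = [Balaban1987RG1] (0.1) p. 251
(the torus) through `B7AvgPeriodicity`.

THE PRINT.  [B7] p. 19: *«In fact, Ω^{(j)} may be replaced by any other lattice.»*; p. 24: *«this definition is local in the sense that Ū^k_c,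
c ⊂ Ω^{(k)}, depends only on the bond variables U_b for b ⊂ B^k(c₋) ∪ B^k(c₊)»*; (136) p. 39: *«C_k(U₀, A) = C_k^{(2)}(U₀, A) + C_k^{(3)}(U₀, A) +
…»*; (149) p. 40: *«|⟨(δ∕δA)C_j(U₀, A), δA⟩| ≦ C₃|A|Q″_j|δA|»* with (141) *«(Q″_kA)_c = Σ_{b⊂Bᵏ(c₋)∪Bᵏ(c₊)} η^dA_b»*; [B11] p. 286 after (56):
*«C_j⁽²⁾(A′, A″) denotes a symmetric bilinear form obtained by polarization from the quadratic form C⁽²⁾(A′)»*; [B9] p. 421: *«The function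
C⁽²⁾(A) is defined at bonds of 𝔅, and on Λ_j it coincides with C_j⁽²⁾(LʲηA)»* (the consumer: the N06 certificate's form letter `𝔠`, memo
`HOME/pub-ymgap-dag-n06-l/C2-INSTANCE-MEMO.md` piece P4).

WHY THIS FILE (cell `pub-ymgap`, seat dag-n06-l g34, programme P-C2).  The N06 member configurations and bond fields live on a discrete torus
(def-Y's `CfgY ∕ FBondY`, Setup's `Site P 0 = Fin (d+1) → ZMod (2L^{m+K})`), while [B7]'s kernel objects (`B7Eq136SecondOrder.CCovIter2`, (149) =
`ineq149_secondOrder`) live on `ℤᵈ` with finitely many inserted variables `ins_S a`.  The bridge is print's p. 24 locality (tree: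
`B9Ineq3137LocalSup.CCovIter_congr`, r20's `B7LocalityGeneral`): `C_j(U₀, B)(c)` reads `B` only on the box `S_c = boxBonds L j c`, so the periodic
extension `ã` of a torus field enters only through the finitely many box values `(ã|_{S_c})` — a continuous linear «box reading» `R_c a` — and every
`ℤᵈ` statement about `C_j(U₀, ins_{S_c} v)(c)` transfers at `v = R_c a`.  This file is carrier-generic (`(ℤ/Tℤ)ᵈ` as `Fin d → ZMod T`, torus bonds
`= (Fin d → ZMod T) × Fin d`); def-Y's `PBond P 0` is that type up to the evident equivalence (the instance file's one line).

WHAT THIS FILE PROVES (0 sorry; definitions with bodies `perExt`, `boxRead`, `torusPol`, `tDelta`; theorems).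
* §1 `perExt` (periodic extension `ã(z, μ) = a(z mod T, μ)`), `boxRead` (`R_c`, a CLM), `boxRead_apply`, `norm_boxRead_le`, `boxRead_star`,
  `agreeOn_perExt_insCfg` (`ã` and `ins_{S_c}(R_c a)` agree on the box), ★ `CCovIter_perExt` ∕ `CCovIter2_perExt` (the remainder and its second-order
  term at `ã` ARE those at `ins_{S_c}(R_c a)` — p. 24 locality).
* §2 `torusPol L U₀ j c := D²[C_j(U₀, ins_{S_c} ·)(c)](0) ∘ (R_c × R_c)` (a continuous bilinear form on torus fields), `torusPol_congr` (it sees `U₀` only on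
  the box — so the regime may be checked on any background agreeing there, e.g. `B7Eq52RetractionExtension.retrCfg`); in the regime of (149):
  ★ `torusPol_symm` ([B11] (56)), ★★ `CCovIter2_perExt_eq_torusPol` (`C_j⁽²⁾(U₀, ã)(c) = ½·P_c(a, a)` — the slice definition is the diagonal),
  `torusPol_eq_polarization` (hence `P_c` is THE polarisation of the torus quadratic form).
* §3 the entries: `tDelta` (`δ_w ⊗ x`), `boxRead_tDelta`, `sum_kerQdd_boxRead_tDelta` (`Σ_s kerQdd(c,s)‖(R_c δ_w⊗x)_s‖ = L^{−jd}·N_c(w)·‖x‖`),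
  `boxCount_le_one` (`N_c(w) ≤ 1` when `2Lʲ ≤ T`), `boxCount_eq_zero` (no box bond over `w` ⇒ `N_c(w) = 0`), ★★ `norm_torusPol_tDelta_le`
  (`‖P_c(a, δ_w ⊗ x)‖ ≤ C₃(Lʲ)²‖a‖·L^{−jd}N_c(w)·‖x‖`), ★ `norm_torusPol_tDelta_le_of_period` (`… ≤ C₃(Lʲ)²‖a‖·L^{−jd}·‖x‖`),
  ★ `torusPol_tDelta_eq_zero` (far `w` ⇒ the entry vanishes).
NOT CLAIMED: the regime itself ((52) for `U₀` is a HYPOTHESIS, as in `B7Eq136SecondOrder`); the identification with def-Y's carriers and the [B9]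
multiscale set `𝔅`; reality (separate file `B7Eq136SecondOrderSkewAdjoint` + one line).
-/

noncomputable section

open scoped BigOperators Topology
open NormedSpace Finset Metric Filter

namespace Literature.MathematicalPhysics.QuantumFieldTheory.Balaban1983to89.B7Eq136SecondOrderPeriodic

open B7Prop1Explicit B7Prop1Local B7Prop2Explicit B7Prop3Flat B7Prop4Flat B7Prop5GeneralOperators B7Prop5GeneralInduction
  B7Prop5GeneralLevels B7Ineq149Pairing B7Eq136SecondOrder B9Ineq3137LocalSup
open B7Prop5Flat (BondIn bondsIn mem_bondsIn restr)
open B12Ineq417Flat (boxBonds)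
open B7AvgPeriodicity (proj torusLift proj_torusLift)

-- `Site` alone would resolve to the torus sites of `Setup.lean`; re-export the `ℤ^d` sites of `B7Prop1Explicit`.
export B7Prop1Explicit (Site)

variable {d : ℕ}

/-! ## §1 Periodic extension, the box reading `R_c`, and p. 24 locality -/

section Chart

variable {𝔸 : Type*} [NormedRing 𝔸] [NormedAlgebra ℂ 𝔸]
variable (T : ℕ) [NeZero T]

/-- **the periodic extension** `ã(z, μ) := a(z mod T, μ)` of a field on the bonds of the torus `(ℤ/Tℤ)ᵈ` to the bonds of `ℤᵈ` ([B12] (0.1): a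
torus configuration «is» a periodic one). [cite: Balaban1987RG1, (0.1) p.251] [cite: Balaban1985Averaging, p.19 («any other lattice»)] -/
def perExt (a : (Fin d → ZMod T) × Fin d → 𝔸) : Site d → Fin d → 𝔸 := fun z μ => a (proj T z, μ)

omit [NormedRing 𝔸] [NormedAlgebra ℂ 𝔸] [NeZero T] in
/-- the periodic extension, evaluated. [cite: Balaban1987RG1, (0.1) p.251, bookkeeping] -/
@[simp] theorem perExt_apply (a : (Fin d → ZMod T) × Fin d → 𝔸) (z : Site d) (μ : Fin d) : perExt T a z μ = a (proj T z, μ) := rfl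

omit [NormedAlgebra ℂ 𝔸] [NeZero T] in
/-- the periodic extension is additive. [cite: Balaban1987RG1, (0.1) p.251, bookkeeping] -/
theorem perExt_add (a a' : (Fin d → ZMod T) × Fin d → 𝔸) : perExt T (a + a') = perExt T a + perExt T a' := rfl

omit [NeZero T] in
/-- the periodic extension is homogeneous. [cite: Balaban1987RG1, (0.1) p.251, bookkeeping] -/
theorem perExt_smul (t : ℂ) (a : (Fin d → ZMod T) × Fin d → 𝔸) : perExt T (t • a) = t • perExt T a := rfl

/-- **the box reading `R_c`**: the values of the periodic extension on the finitely many bonds of a set `S ⊂ ℤᵈ × {directions}` (for `S = S_c` the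
bonds of `Bʲ(c₋) ∪ Bʲ(c₊)`: «the variables A_b, b ⊂ B(c₋) ∪ B(c₊)», p. 24 ∕ p. 38), as a continuous linear map.
[cite: Balaban1985Averaging, p.24 (locality), Proposition 4 p.38] -/
def boxRead (S : Finset (Site d × Fin d)) : ((Fin d → ZMod T) × Fin d → 𝔸) →L[ℂ] (S → 𝔸) :=
  ContinuousLinearMap.pi fun s : S =>
    ContinuousLinearMap.proj (R := ℂ) (φ := fun _ : (Fin d → ZMod T) × Fin d => 𝔸) (proj T s.1.1, s.1.2)

omit [NeZero T] in
/-- the box reading, evaluated. [cite: Balaban1985Averaging, p.24, bookkeeping] -/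
@[simp] theorem boxRead_apply (S : Finset (Site d × Fin d)) (a : (Fin d → ZMod T) × Fin d → 𝔸) (s : S) :
    boxRead T S a s = a (proj T s.1.1, s.1.2) := rfl

/-- `‖R_c a‖ ≤ ‖a‖_∞`. [cite: Balaban1985Averaging, p.24, bookkeeping] -/
theorem norm_boxRead_le (S : Finset (Site d × Fin d)) (a : (Fin d → ZMod T) × Fin d → 𝔸) : ‖boxRead T S a‖ ≤ ‖a‖ := by
  refine (pi_norm_le_iff_of_nonneg (norm_nonneg a)).2 fun s => ?_
  rw [boxRead_apply]
  exact norm_le_pi_norm a _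

omit [NeZero T] in
/-- the box reading commutes with the adjoint (for the reality law of `P_c`, `B7Eq136SecondOrderSkewAdjoint`). [cite: Balaban1985Averaging, (22)–(23) p.21, bookkeeping] -/
theorem boxRead_star [Star 𝔸] (S : Finset (Site d × Fin d)) (a : (Fin d → ZMod T) × Fin d → 𝔸) :
    boxRead T S (star a) = star (boxRead T S a) := rfl

omit [NeZero T] in
/-- `R_c` restricted to the box is the restriction of the periodic extension: `ã` and `ins_S(R_c a)` AGREE on every bond of `S`, in particular on the box
when `S = S_c`. [cite: Balaban1985Averaging, p.24 (locality), bookkeeping] -/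
theorem agreeOn_perExt_insCfg (lo hi : Site d) (a : (Fin d → ZMod T) × Fin d → 𝔸) :
    AgreeOn lo hi (perExt T a) (insCfg (bondsIn lo hi) (boxRead T (bondsIn lo hi) a)) := by
  intro x μ hx hxe
  have hmem : (x, μ) ∈ bondsIn lo hi := mem_bondsIn.2 ⟨hx, hxe⟩
  simp only [perExt_apply, insCfg, hmem, dite_true, boxRead_apply]

variable [CompleteSpace 𝔸]

omit [NeZero T] in
/-- ★ **p. 24 LOCALITY AT THE PERIODIC EXTENSION**: `C_j(U₀, ã)(c) = C_j(U₀, ins_{S_c}(R_c a))(c)` — the remainder at the periodic extension of a torus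
field is the remainder at the finitely many inserted box values. [cite: Balaban1985Averaging, (150) p.40, p.24 (after (43)), p.31 (after (91))] -/
theorem CCovIter_perExt (L : ℕ) (hL : 1 ≤ L) (U₀ : Site d → Fin d → 𝔸ˣ) (j : ℕ) (z : Site d) (κ : Fin d)
    (a : (Fin d → ZMod T) × Fin d → 𝔸) :
    CCovIter L U₀ (perExt T a) j z κ = CCovIter L U₀ (insCfg (boxBonds L j z κ) (boxRead T (boxBonds L j z κ) a)) j z κ :=
  CCovIter_congr L hL j z κ (fun _ _ _ _ => rfl) (agreeOn_perExt_insCfg T _ _ a)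

omit [NeZero T] in
/-- ★ the same for the second-order term (136): `C_j⁽²⁾(U₀, ã)(c) = C_j⁽²⁾(U₀, ins_{S_c}(R_c a))(c)` (the complex slices agree pointwise).
[cite: Balaban1985Averaging, (136) p.39, p.24 (after (43))] -/
theorem CCovIter2_perExt (L : ℕ) (hL : 1 ≤ L) (U₀ : Site d → Fin d → 𝔸ˣ) (j : ℕ) (z : Site d) (κ : Fin d)
    (a : (Fin d → ZMod T) × Fin d → 𝔸) :
    CCovIter2 L U₀ (perExt T a) j z κ = CCovIter2 L U₀ (insCfg (boxBonds L j z κ) (boxRead T (boxBonds L j z κ) a)) j z κ := by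
  rw [CCovIter2, CCovIter2]
  congr 1
  have hslice : (fun t : ℂ => CCovIter L U₀ (t • perExt T a) j z κ) =
      fun t : ℂ => CCovIter L U₀ (t • insCfg (boxBonds L j z κ) (boxRead T (boxBonds L j z κ) a)) j z κ := by
    funext t
    rw [← perExt_smul, ← insCfg_smul, ← map_smul]
    exact CCovIter_perExt T L hL U₀ j z κ (t • a)
  rw [hslice]

end Chart

/-! ## §2 The polarisation `P_c` on torus fields -/

section Polarisation

variable {𝔸 : Type*} [NormedRing 𝔸] [NormedAlgebra ℂ 𝔸] [CompleteSpace 𝔸]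
variable (T : ℕ) [NeZero T]

/-- **`P_c`, the polarised second-order form at the coarse bond `c = (z, κ)` on torus bond fields**: the second Fréchet derivative at `0` of
`v ↦ C_j(U₀, ins_{S_c} v)(c)` on the box variables, read through `R_c` in both slots — [B11] (56)'s «symmetric bilinear form obtained by polarization»,
for fields on the torus. [cite: Balaban1985Averaging, (136) p.39, p.24] [cite: Balaban1985Variational, (56) p.286] -/
def torusPol (L : ℕ) (U₀ : Site d → Fin d → 𝔸ˣ) (j : ℕ) (z : Site d) (κ : Fin d) :
    ((Fin d → ZMod T) × Fin d → 𝔸) →L[ℂ] ((Fin d → ZMod T) × Fin d → 𝔸) →L[ℂ] 𝔸 :=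
  (fderiv ℂ (fderiv ℂ (fun v : ↥(boxBonds L j z κ) → 𝔸 => CCovIter L U₀ (insCfg (boxBonds L j z κ) v) j z κ)) 0).bilinearComp
    (boxRead T (boxBonds L j z κ)) (boxRead T (boxBonds L j z κ))

/-- `P_c` evaluated. [cite: Balaban1985Averaging, (136) p.39, bookkeeping] -/
theorem torusPol_apply (L : ℕ) (U₀ : Site d → Fin d → 𝔸ˣ) (j : ℕ) (z : Site d) (κ : Fin d) (a a' : (Fin d → ZMod T) × Fin d → 𝔸) :
    torusPol T L U₀ j z κ a a' =
      fderiv ℂ (fderiv ℂ (fun v : ↥(boxBonds L j z κ) → 𝔸 => CCovIter L U₀ (insCfg (boxBonds L j z κ) v) j z κ)) 0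
        (boxRead T (boxBonds L j z κ) a) (boxRead T (boxBonds L j z κ) a') := rfl

/-- **`P_c` DEPENDS ON THE BACKGROUND ONLY THROUGH THE BOX** (p. 24 locality in `U₀`, `B9Ineq3137LocalSup.CCovIter_congr`): two backgrounds agreeing on
`Bʲ(c₋) ∪ Bʲ(c₊)` have the same `P_c` — so the regime hypotheses ((52) …) may be verified on ANY background agreeing with `U₀` on the box (e.g. the
retraction extension of `B7Eq52RetractionExtension`). [cite: Balaban1985Averaging, p.24 (locality), (136) p.39] -/
theorem torusPol_congr (L : ℕ) (hL : 1 ≤ L) {U₀ U₀' : Site d → Fin d → 𝔸ˣ} (j : ℕ) (z : Site d) (κ : Fin d)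
    (h₀ : AgreeOn (loK L j z) (bondHiK L j z κ) U₀ U₀') : torusPol T L U₀ j z κ = torusPol T L U₀' j z κ := by
  unfold torusPol
  have hf : (fun v : ↥(boxBonds L j z κ) → 𝔸 => CCovIter L U₀ (insCfg (boxBonds L j z κ) v) j z κ) =
      fun v : ↥(boxBonds L j z κ) → 𝔸 => CCovIter L U₀' (insCfg (boxBonds L j z κ) v) j z κ :=
    funext fun v => CCovIter_congr L hL j z κ h₀ (fun _ _ _ _ => rfl)
  rw [hf]

variable [NormOneClass 𝔸]
variable (L : ℕ) (hL : 2 ≤ L) {G : Subgroup 𝔸ˣ} (hG : AvgClosed d L G) (k : ℕ)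
  (U₀ : Site d → Fin d → 𝔸ˣ) (hU₀ : ∀ x κ, U₀ x κ ∈ G) {α₀ : ℝ} (hα : 0 < α₀)
  (hα3 : C0 d * α₀ ≤ 1 / 3) (hα4 : 4 * α₀ ≤ c2' d L) (h52 : pdev U₀ < α₀ * (((L : ℝ) ^ k)⁻¹) ^ 2)
  {b : ℝ} (hb : 0 < b)
  (hsmall : Real.exp (4 * (800 * ((d : ℝ) + 1) ^ 2 * ((d : ℝ) + 4)) * α₀)
    * (1 + 8 * (131072 * ((d : ℝ) + 1) ^ 2) * ((L : ℝ) ^ k * b)) ≤ 2)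
  (hc₃ : 4 * ((L : ℝ) ^ k * b) < c3 d L)
  (h145 : 8 * d * thetaGen d L α₀ * (L : ℝ)⁻¹ ^ 4 ≤ 1)
  (h155 : (2 * (L : ℝ) - 1) * (L : ℝ)⁻¹ ^ 2 + 2 * d * thetaGen d L α₀ * (L : ℝ)⁻¹ ^ 3
    + 1 / 8 * (1 + 2 * d * thetaGen d L α₀ * (L : ℝ)⁻¹ ^ 2 + 2 * d * C3Gen d L * ((L : ℝ) ^ k * b)) * (L : ℝ)⁻¹ ^ 2 ≤ 1)

include hL hG hU₀ hα hα3 hα4 h52 hb hsmall hc₃ in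
/-- ★ **`P_c` IS SYMMETRIC** ([B11] (56)). [cite: Balaban1985Variational, (56) p.286] [cite: Balaban1985Averaging, (136) p.39] -/
theorem torusPol_symm {j : ℕ} (hj : j ≤ k) (z : Site d) (κ : Fin d) (a a' : (Fin d → ZMod T) × Fin d → 𝔸) :
    torusPol T L U₀ j z κ a a' = torusPol T L U₀ j z κ a' a := by
  rw [torusPol_apply, torusPol_apply]
  exact snd_fderiv_CCovIter_ins_symm L hL hG k U₀ hU₀ hα hα3 hα4 h52 hb hsmall hc₃ _ hj z κ _ _

include hL hG hU₀ hα hα3 hα4 h52 hb hsmall hc₃ in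
/-- ★★ **`C_j⁽²⁾(U₀, ã)(c) = ½·P_c(a, a)`** — the second-order term (136) at the periodic extension of a torus field IS the diagonal of the torus
polarisation (p. 24 locality + `B7Eq136SecondOrder.CCovIter2_ins_eq`). [cite: Balaban1985Averaging, (136)–(137) p.39, p.24] [cite: Balaban1985Variational, (56) p.286] -/
theorem CCovIter2_perExt_eq_torusPol {j : ℕ} (hj : j ≤ k) (z : Site d) (κ : Fin d) (a : (Fin d → ZMod T) × Fin d → 𝔸) :
    CCovIter2 L U₀ (perExt T a) j z κ = (2 : ℂ)⁻¹ • torusPol T L U₀ j z κ a a := by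
  rw [CCovIter2_perExt T L (le_trans (by norm_num) hL) U₀ j z κ a, torusPol_apply,
    CCovIter2_ins_eq L hL hG k U₀ hU₀ hα hα3 hα4 h52 hb hsmall hc₃ _ hj z κ]

include hL hG hU₀ hα hα3 hα4 h52 hb hsmall hc₃ in
/-- hence `P_c` IS the polarisation of the torus quadratic form `a ↦ C_j⁽²⁾(U₀, ã)(c)`:
`P_c(a, a′) = C_j⁽²⁾(U₀, (a+a′)~)(c) − C_j⁽²⁾(U₀, ã)(c) − C_j⁽²⁾(U₀, ã′)(c)`. [cite: Balaban1985Variational, (56) p.286] [cite: Balaban1985Averaging, (136) p.39] -/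
theorem torusPol_eq_polarization {j : ℕ} (hj : j ≤ k) (z : Site d) (κ : Fin d) (a a' : (Fin d → ZMod T) × Fin d → 𝔸) :
    torusPol T L U₀ j z κ a a' =
      CCovIter2 L U₀ (perExt T (a + a')) j z κ - CCovIter2 L U₀ (perExt T a) j z κ - CCovIter2 L U₀ (perExt T a') j z κ := by
  have hs := torusPol_symm T L hL hG k U₀ hU₀ hα hα3 hα4 h52 hb hsmall hc₃ hj z κ a' a
  rw [CCovIter2_perExt_eq_torusPol T L hL hG k U₀ hU₀ hα hα3 hα4 h52 hb hsmall hc₃ hj,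
    CCovIter2_perExt_eq_torusPol T L hL hG k U₀ hU₀ hα hα3 hα4 h52 hb hsmall hc₃ hj,
    CCovIter2_perExt_eq_torusPol T L hL hG k U₀ hU₀ hα hα3 hα4 h52 hb hsmall hc₃ hj]
  simp only [map_add, FunLike.coe_add, Pi.add_apply, hs]
  set P := torusPol T L U₀ j z κ a a'
  set X := torusPol T L U₀ j z κ a a
  set Y := torusPol T L U₀ j z κ a' a'
  have h2 : X + P + (P + Y) = (X + Y) + (2 : ℂ) • P := by rw [two_smul]; abel
  rw [h2, smul_add, smul_smul, inv_mul_cancel₀ two_ne_zero, one_smul, smul_add]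
  abel

end Polarisation

/-! ## §3 The entries of `P_c`: print's (149) shape on the torus -/

section Entries

variable {𝔸 : Type*} [NormedRing 𝔸] [NormedAlgebra ℂ 𝔸] [CompleteSpace 𝔸]
variable (T : ℕ) [NeZero T]

open Classical in
/-- the torus test field `δ_w ⊗ x` (value `x` at the torus bond `w`, `0` elsewhere). [cite: Balaban1985Averaging, (137)–(138) p.39 (variations bond by bond), bookkeeping] -/
def tDelta (w : (Fin d → ZMod T) × Fin d) (x : 𝔸) : (Fin d → ZMod T) × Fin d → 𝔸 := fun b => if b = w then x else 0

omit [NormedAlgebra ℂ 𝔸] [CompleteSpace 𝔸] [NeZero T] in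
open Classical in
/-- `δ_w ⊗ x` evaluated. [cite: Balaban1985Averaging, (137)–(138) p.39, bookkeeping] -/
@[simp] theorem tDelta_apply (w b : (Fin d → ZMod T) × Fin d) (x : 𝔸) : tDelta T w x b = if b = w then x else 0 := rfl

omit [CompleteSpace 𝔸] [NeZero T] in
open Classical in
/-- the box reading of `δ_w ⊗ x`: `x` at the box bonds projecting to `w`, `0` at the others. [cite: Balaban1985Averaging, (141) p.39, bookkeeping] -/
theorem norm_boxRead_tDelta (S : Finset (Site d × Fin d)) (w : (Fin d → ZMod T) × Fin d) (x : 𝔸) (s : S) :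
    ‖boxRead T S (tDelta T w x) s‖ = if (proj T s.1.1, s.1.2) = w then ‖x‖ else 0 := by
  rw [boxRead_apply, tDelta_apply]
  split_ifs <;> simp

open Classical in
/-- **`N_S(w)`**, the number of bonds of `S` (the box `Bʲ(c₋) ∪ Bʲ(c₊)`) lying over the torus bond `w` — the torus form of the column count of (141).
[cite: Balaban1985Averaging, (141) p.39] [cite: Balaban1987RG1, (0.1) p.251] -/
def boxCount (S : Finset (Site d × Fin d)) (w : (Fin d → ZMod T) × Fin d) : ℕ := (S.filter fun s => (proj T s.1, s.2) = w).card

omit [CompleteSpace 𝔸] [NeZero T] in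
open Classical in
/-- **the (141)-weighted box sum of `R_c(δ_w ⊗ x)` is `L^{−jd}·N_c(w)·‖x‖`**. [cite: Balaban1985Averaging, (141) p.39] -/
theorem sum_kerQdd_boxRead_tDelta (L j : ℕ) (z : Site d) (κ : Fin d) (w : (Fin d → ZMod T) × Fin d) (x : 𝔸) :
    ∑ s : ↥(boxBonds L j z κ), kerQdd L j z κ s.1.1 s.1.2 * ‖boxRead T (boxBonds L j z κ) (tDelta T w x) s‖ =
      (((L : ℝ) ^ j) ^ d)⁻¹ * (boxCount T (boxBonds L j z κ) w : ℝ) * ‖x‖ := by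
  have hterm : ∀ s : ↥(boxBonds L j z κ), kerQdd L j z κ s.1.1 s.1.2 * ‖boxRead T (boxBonds L j z κ) (tDelta T w x) s‖ =
      (((L : ℝ) ^ j) ^ d)⁻¹ * ‖x‖ * (if (proj T s.1.1, s.1.2) = w then 1 else 0) := by
    intro s
    have hin : BondIn (loK L j z) (bondHiK L j z κ) s.1.1 s.1.2 := mem_bondsIn.1 s.2
    rw [kerQdd_of_bondIn hin, norm_boxRead_tDelta]
    split_ifs <;> simp
  rw [Finset.sum_congr rfl fun s _ => hterm s, ← Finset.mul_sum, boxCount, Finset.natCast_card_filter,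
    ← Finset.sum_coe_sort (boxBonds L j z κ)]
  ring

omit [NeZero T] in
/-- the box `Bʲ(c₋) ∪ Bʲ(c₊)` has side `≤ 2Lʲ` in every direction. [cite: Balaban1985Averaging, p.24 (the box), bookkeeping] -/
theorem box_side_le (L j : ℕ) (z : Site d) (κ : Fin d) {y : Site d} (hy : InBox (loK L j z) (bondHiK L j z κ) y) (i : Fin d) :
    loK L j z i ≤ y i ∧ y i ≤ loK L j z i + (2 * (L : ℤ) ^ j - 1) := by
  obtain ⟨h1, h2⟩ := hy i
  refine ⟨h1, h2.trans ?_⟩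
  simp only [loK, bondHiK]
  split_ifs <;> nlinarith [pow_nonneg (Int.natCast_nonneg L) j]

omit [NeZero T] in
/-- **`N_c(w) ≤ 1` ONCE THE BOX FITS IN ONE PERIOD** (`2Lʲ ≤ T`): two box bonds over the same torus bond are congruent modulo `T` coordinatewise and
closer than `T`, hence equal. [cite: Balaban1987RG1, (0.1) p.251] [cite: Balaban1985Averaging, (141) p.39] -/
theorem boxCount_le_one (L j : ℕ) (hT : 2 * L ^ j ≤ T) (z : Site d) (κ : Fin d) (w : (Fin d → ZMod T) × Fin d) :
    boxCount T (boxBonds L j z κ) w ≤ 1 := by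
  classical
  rw [boxCount, Finset.card_le_one]
  intro s hs s' hs'
  rw [Finset.mem_filter] at hs hs'
  obtain ⟨hsS, hsw⟩ := hs
  obtain ⟨hs'S, hs'w⟩ := hs'
  have hy : InBox (loK L j z) (bondHiK L j z κ) s.1 := (mem_bondsIn.1 hsS).1
  have hy' : InBox (loK L j z) (bondHiK L j z κ) s'.1 := (mem_bondsIn.1 hs'S).1
  have hμ : s.2 = s'.2 := by
    have h1 := congrArg Prod.snd hsw; have h2 := congrArg Prod.snd hs'w
    simp only at h1 h2; rw [h1, h2]
  have hproj : proj T s.1 = proj T s'.1 := by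
    have h1 := congrArg Prod.fst hsw; have h2 := congrArg Prod.fst hs'w
    simp only at h1 h2; rw [h1, h2]
  have hsite : s.1 = s'.1 := by
    funext i
    have hc : ((s.1 i : ℤ) : ZMod T) = ((s'.1 i : ℤ) : ZMod T) := by
      have := congrFun hproj i; simpa [proj] using this
    have hdvd : (T : ℤ) ∣ s'.1 i - s.1 i := (ZMod.intCast_eq_intCast_iff_dvd_sub _ _ _).1 hc
    obtain ⟨h1, h2⟩ := box_side_le L j z κ hy i
    obtain ⟨h1', h2'⟩ := box_side_le L j z κ hy' i
    have hT' : (2 : ℤ) * (L : ℤ) ^ j ≤ (T : ℤ) := by exact_mod_cast hT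
    have habs : (s'.1 i - s.1 i).natAbs < (T : ℤ).natAbs := by
      rw [Int.natAbs_natCast]
      have : |s'.1 i - s.1 i| < (T : ℤ) := by rw [abs_lt]; constructor <;> linarith
      omega
    have h0 := Int.eq_zero_of_dvd_of_natAbs_lt_natAbs hdvd habs
    linarith
  exact Prod.ext hsite hμ

omit [NeZero T] in
/-- `N_c(w) = 0` when no bond of the box lies over `w` (the far torus bonds). [cite: Balaban1985Averaging, (141) p.39, bookkeeping] -/
theorem boxCount_eq_zero {S : Finset (Site d × Fin d)} {w : (Fin d → ZMod T) × Fin d} (h : ∀ s ∈ S, (proj T s.1, s.2) ≠ w) :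
    boxCount T S w = 0 := by
  classical
  rw [boxCount, Finset.card_eq_zero, Finset.filter_eq_empty_iff]
  exact fun s hs => h s hs

variable [NormOneClass 𝔸]
variable (L : ℕ) (hL : 2 ≤ L) {G : Subgroup 𝔸ˣ} (hG : AvgClosed d L G) (k : ℕ)
  (U₀ : Site d → Fin d → 𝔸ˣ) (hU₀ : ∀ x κ, U₀ x κ ∈ G) {α₀ : ℝ} (hα : 0 < α₀)
  (hα3 : C0 d * α₀ ≤ 1 / 3) (hα4 : 4 * α₀ ≤ c2' d L) (h52 : pdev U₀ < α₀ * (((L : ℝ) ^ k)⁻¹) ^ 2)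
  {b : ℝ} (hb : 0 < b)
  (hsmall : Real.exp (4 * (800 * ((d : ℝ) + 1) ^ 2 * ((d : ℝ) + 4)) * α₀)
    * (1 + 8 * (131072 * ((d : ℝ) + 1) ^ 2) * ((L : ℝ) ^ k * b)) ≤ 2)
  (hc₃ : 4 * ((L : ℝ) ^ k * b) < c3 d L)
  (h145 : 8 * d * thetaGen d L α₀ * (L : ℝ)⁻¹ ^ 4 ≤ 1)
  (h155 : (2 * (L : ℝ) - 1) * (L : ℝ)⁻¹ ^ 2 + 2 * d * thetaGen d L α₀ * (L : ℝ)⁻¹ ^ 3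
    + 1 / 8 * (1 + 2 * d * thetaGen d L α₀ * (L : ℝ)⁻¹ ^ 2 + 2 * d * C3Gen d L * ((L : ℝ) ^ k * b)) * (L : ℝ)⁻¹ ^ 2 ≤ 1)

include hL hG hU₀ hα hα3 hα4 h52 hb hsmall hc₃ h145 h155 in
/-- ★★ **THE ENTRIES OF `P_c` — (149) ON THE TORUS**: for every torus field `a`, torus bond `w` and `x ∈ 𝔸`,
`‖P_c(a, δ_w ⊗ x)‖ ≤ C₃·(Lʲ)²·‖a‖_∞·(L^{−jd}·N_c(w)·‖x‖)` — print's «C₃|A|Q″_j|δA|» (`B7Eq136SecondOrder.norm_snd_fderiv_CCovIter_ins_le`) at the box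
values, with `‖R_c a‖ ≤ ‖a‖_∞` and the (141)-weighted count of §3. [cite: Balaban1985Averaging, (149) p.40, (141) p.39, (136) p.39] [cite: Balaban1987RG1, (0.1) p.251] -/
theorem norm_torusPol_tDelta_le {j : ℕ} (hj : j ≤ k) (z : Site d) (κ : Fin d) (a : (Fin d → ZMod T) × Fin d → 𝔸)
    (w : (Fin d → ZMod T) × Fin d) (x : 𝔸) :
    ‖torusPol T L U₀ j z κ a (tDelta T w x)‖ ≤
      C3Gen d L * ((L : ℝ) ^ j) ^ 2 * ‖a‖ * ((((L : ℝ) ^ j) ^ d)⁻¹ * (boxCount T (boxBonds L j z κ) w : ℝ) * ‖x‖) := by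
  rw [torusPol_apply]
  have h := norm_snd_fderiv_CCovIter_ins_le L hL hG k U₀ hU₀ hα hα3 hα4 h52 hb hsmall hc₃ h145 h155 (boxBonds L j z κ) hj z κ
    (boxRead T (boxBonds L j z κ) a) (boxRead T (boxBonds L j z κ) (tDelta T w x))
  rw [sum_kerQdd_boxRead_tDelta] at h
  refine h.trans ?_
  have hC : 0 ≤ C3Gen d L := by unfold C3Gen C1ppGen; positivity
  have hR : 0 ≤ (((L : ℝ) ^ j) ^ d)⁻¹ * (boxCount T (boxBonds L j z κ) w : ℝ) * ‖x‖ := by positivity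
  exact mul_le_mul_of_nonneg_right (mul_le_mul_of_nonneg_left (norm_boxRead_le T _ a) (by positivity)) hR

include hL hG hU₀ hα hα3 hα4 h52 hb hsmall hc₃ h145 h155 in
/-- ★ **… once the box fits in one period** (`2Lʲ ≤ T`): `‖P_c(a, δ_w ⊗ x)‖ ≤ C₃·(Lʲ)²·‖a‖_∞·L^{−jd}·‖x‖` — the bound print's (149) gives for a variation
on ONE bond. [cite: Balaban1985Averaging, (149) p.40, (141) p.39] [cite: Balaban1987RG1, (0.1) p.251] -/
theorem norm_torusPol_tDelta_le_of_period {j : ℕ} (hj : j ≤ k) (hT : 2 * L ^ j ≤ T) (z : Site d) (κ : Fin d)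
    (a : (Fin d → ZMod T) × Fin d → 𝔸) (w : (Fin d → ZMod T) × Fin d) (x : 𝔸) :
    ‖torusPol T L U₀ j z κ a (tDelta T w x)‖ ≤ C3Gen d L * ((L : ℝ) ^ j) ^ 2 * ‖a‖ * ((((L : ℝ) ^ j) ^ d)⁻¹ * ‖x‖) := by
  refine (norm_torusPol_tDelta_le T L hL hG k U₀ hU₀ hα hα3 hα4 h52 hb hsmall hc₃ h145 h155 hj z κ a w x).trans ?_
  have hC : 0 ≤ C3Gen d L := by unfold C3Gen C1ppGen; positivity
  have hN : (boxCount T (boxBonds L j z κ) w : ℝ) ≤ 1 := by exact_mod_cast boxCount_le_one T L j hT z κ w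
  have h1 : (((L : ℝ) ^ j) ^ d)⁻¹ * (boxCount T (boxBonds L j z κ) w : ℝ) * ‖x‖ ≤ (((L : ℝ) ^ j) ^ d)⁻¹ * ‖x‖ := by
    have := mul_le_mul_of_nonneg_left hN (by positivity : (0 : ℝ) ≤ (((L : ℝ) ^ j) ^ d)⁻¹)
    rw [mul_one] at this
    exact mul_le_mul_of_nonneg_right this (norm_nonneg x)
  exact mul_le_mul_of_nonneg_left h1 (by positivity)

include hL hG hU₀ hα hα3 hα4 h52 hb hsmall hc₃ h145 h155 in
/-- ★ **FAR TORUS BONDS GIVE ZERO ENTRIES**: if no bond of the box `Bʲ(c₋) ∪ Bʲ(c₊)` lies over `w` then `P_c(a, δ_w ⊗ x) = 0` for every `a` — p. 24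
locality of the second argument. [cite: Balaban1985Averaging, p.24 (locality), (141) p.39, (149) p.40] -/
theorem torusPol_tDelta_eq_zero {j : ℕ} (hj : j ≤ k) (z : Site d) (κ : Fin d) (a : (Fin d → ZMod T) × Fin d → 𝔸)
    {w : (Fin d → ZMod T) × Fin d} (hw : ∀ s ∈ boxBonds L j z κ, (proj T s.1, s.2) ≠ w) (x : 𝔸) :
    torusPol T L U₀ j z κ a (tDelta T w x) = 0 := by
  have h := norm_torusPol_tDelta_le T L hL hG k U₀ hU₀ hα hα3 hα4 h52 hb hsmall hc₃ h145 h155 hj z κ a w x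
  rw [boxCount_eq_zero T hw, Nat.cast_zero, mul_zero, zero_mul, mul_zero] at h
  exact norm_le_zero_iff.1 h

end Entries

end Literature.MathematicalPhysics.QuantumFieldTheory.Balaban1983to89.B7Eq136SecondOrderPeriodic
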